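import Mathlib
import HarnessLib

/-!
# Stub `stub_translationCalculus` — crux `TorsionLogs.NeronTorsionSector`, line `registered` (block U4)

Explicit calculus of the translation by a point `P₁ = (x₁, y₁)` of the real cubic
`y² = f(x) = 4x³ − g₂x − g₃`, written in REGULAR CHORD FORM.  Along a branch `yb = ε√f` (`ε = ±1`)
the chord of `(x, yb x)` with `P₁` has slope `sl = M(x)/(yb + y₁)`, `M(x) = 4x² + 4xx₁ + 4x₁² − g₂`
(this is `(yb − y₁)/(x − x₁)` off `x = x₁`, because `(yb − y₁)(yb + y₁) = f(x) − f(x₁) = (x − x₁)M(x)`,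
and it is regular through the duplication point); the sum point is `X3 = sl²/4 − x − x₁`,
`Y3 = −(yb + sl (X3 − x))`, and the cocycle potential is `Qf = sl/2 + Y3/(2 X3) − yb/(2x)`.

We prove: (a) `Y3² = f(X3)` (a polynomial identity modulo `yb² = f(x)`, `y₁² = f(x₁)` and the chord
relation `yb − y₁ = sl (x − x₁)`); (b) translation invariance of `dx/y`: `X3′ = Y3/yb`, from
`2·yb·yb′ = f′` and the key identity `2·yb·sl′ + sl² = 8x + 4x₁` (whose polynomial content is
`f′(x)(x − x₁) − (f(x) − f(x₁)) = 4(x − x₁)²(2x + x₁)`); (c) `Qf′ = (h(X3) − h(x))/yb` with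
`h(t) = (g₂t + 2g₃)/(4t²)`: with `D := yb·d/dx` one has `D(yb/(2x)) = x + h(x)`,
`D(Y3/(2X3)) = X3 + h(X3)` (using `yb·Y3′ = f′(X3)/2`, `yb·X3′ = Y3`, `Y3² = f(X3)`), and
`D(sl/2) = x − X3`; (d) point symmetry: the regular-form chord of `(x₃, −y₃)` with `P₁` returns
`(x, −y)` with the same slope, so the potential takes the same value.

All derivative bookkeeping is `HasDerivAt` calculus (`HasDerivAt.sqrt`, `.fun_div`, `.fun_pow`, …);
all the remaining identities are closed by `linear_combination`.

References: J. H. Silverman, *The Arithmetic of Elliptic Curves* (2nd ed., 2009), III.2.3 (group law)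
and III.5.1 (invariant differential); D. F. Lawden, *Elliptic Functions and Applications* (1989),
§6.8.
-/

noncomputable section

-- `Summit.KontsevichZagierPeriods.KontsevichZagierPeriods.…` is the tree's mandated layout (single-conjunct summit).
set_option linter.dupNamespace false

namespace Summit.KontsevichZagierPeriods.KontsevichZagierPeriods.Cruxes.NeronTorsionSector.Translation

/-- **Chord relation in regular form.** If `Y² = f(x)`, `y₁² = f(x₁)` and `s (Y + y₁) = M(x)` with
`Y + y₁ ≠ 0`, then `Y − y₁ = s (x − x₁)`: indeed `(Y − y₁)(Y + y₁) = f(x) − f(x₁) = (x − x₁) M(x)`. -/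
theorem translCalc_chord {x x₁ Y y₁ s g₂ g₃ : ℝ} (h1 : Y ^ 2 = 4 * x ^ 3 - g₂ * x - g₃)
    (h0 : y₁ ^ 2 = 4 * x₁ ^ 3 - g₂ * x₁ - g₃)
    (hM : s * (Y + y₁) = 4 * x ^ 2 + 4 * x * x₁ + 4 * x₁ ^ 2 - g₂) (hne : Y + y₁ ≠ 0) :
    Y - y₁ = s * (x - x₁) := by
  have h : (Y - y₁) * (Y + y₁) = s * (x - x₁) * (Y + y₁) := by
    linear_combination h1 - h0 - (x - x₁) * hM
  exact mul_right_cancel₀ hne h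

/-- **The sum point lies on the curve** (part (a) as a polynomial identity): with `X3 = s²/4 − x − x₁`
and `Y3 = −(Y + s (X3 − x))`, `Y3² = f(X3)` follows from `Y² = f(x)`, the chord relation and
`s (Y + y₁) = M(x)`. -/
theorem translCalc_onCurve {x x₁ Y y₁ s g₂ g₃ : ℝ} (h1 : Y ^ 2 = 4 * x ^ 3 - g₂ * x - g₃)
    (hch : Y - y₁ = s * (x - x₁))
    (hM : s * (Y + y₁) = 4 * x ^ 2 + 4 * x * x₁ + 4 * x₁ ^ 2 - g₂) :
    (-(Y + s * (s ^ 2 / 4 - x - x₁ - x))) ^ 2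
      = 4 * (s ^ 2 / 4 - x - x₁) ^ 3 - g₂ * (s ^ 2 / 4 - x - x₁) - g₃ := by
  linear_combination h1 + (s ^ 2 / 4 - x - x₁ - x) * hM + s * (s ^ 2 / 4 - x - x₁ - x) * hch

/-- **Key identity for the derivative of the regular-form slope**: with `2 Y Y′ = f′(x)`,
`s (Y + y₁) = M(x)` and the chord relation, the derivative
`s′ = (M′(x)(Y + y₁) − M(x) Y′)/(Y + y₁)²` satisfies `2 Y s′ + s² = 8x + 4x₁`. -/
theorem translCalc_key {x x₁ Y Y' y₁ s g₂ : ℝ} (hne : Y + y₁ ≠ 0)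
    (hYY : 2 * Y * Y' = 12 * x ^ 2 - g₂)
    (hM : s * (Y + y₁) = 4 * x ^ 2 + 4 * x * x₁ + 4 * x₁ ^ 2 - g₂) (hch : Y - y₁ = s * (x - x₁)) :
    2 * Y * (((8 * x + 4 * x₁) * (Y + y₁) - (4 * x ^ 2 + 4 * x * x₁ + 4 * x₁ ^ 2 - g₂) * Y')
        / (Y + y₁) ^ 2) + s ^ 2 = 8 * x + 4 * x₁ := by
  have h2 : (Y + y₁) ^ 2 ≠ 0 := pow_ne_zero 2 hne
  rw [mul_div_assoc', div_add' _ _ _ h2, div_eq_iff h2]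
  linear_combination -(4 * x ^ 2 + 4 * x * x₁ + 4 * x₁ ^ 2 - g₂) * hYY
    + (s * (Y + y₁) + (4 * x ^ 2 + 4 * x * x₁ + 4 * x₁ ^ 2 - g₂)) * hM
    + 4 * (2 * x + x₁) * (x - x₁) * hM + (8 * x + 4 * x₁) * (Y + y₁) * hch

/-- **The cocycle identity behind part (c)**, in abstract form.  Write `P = X3`, `W = Y3`, `P′ = W/Y`
(part (b)), `W′ = −(Y′ + s′(P − x) + s(P′ − 1))`.  From `2YY′ = f′(x)`, `2Ys′ + s² = 8x + 4x₁`, the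
chord relations and the two curve equations `Y² = f(x)`, `W² = f(P)`:
`s′/2 + (W′·2P − W·2P′)/(2P)² − (Y′·2x − 2Y)/(2x)² = (h(P) − h(x))/Y`, `h(t) = (g₂t + 2g₃)/(4t²)`. -/
theorem translCalc_QfIdentity {x x₁ g₂ g₃ Y Y' y₁ s s' P W : ℝ} (hY0 : Y ≠ 0) (hP0 : P ≠ 0)
    (hx0 : x ≠ 0) (hYY : 2 * Y * Y' = 12 * x ^ 2 - g₂)
    (hkey : 2 * Y * s' + s ^ 2 = 8 * x + 4 * x₁)
    (hP : P = s ^ 2 / 4 - x - x₁) (hW : W = -(Y + s * (P - x)))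
    (hM : s * (Y + y₁) = 4 * x ^ 2 + 4 * x * x₁ + 4 * x₁ ^ 2 - g₂) (hch : Y - y₁ = s * (x - x₁))
    (hW2 : W ^ 2 = 4 * P ^ 3 - g₂ * P - g₃) (hY2 : Y ^ 2 = 4 * x ^ 3 - g₂ * x - g₃) :
    s' / 2 + (-(Y' + (s' * (P - x) + s * (W / Y - 1))) * (2 * P) - W * (2 * (W / Y)))
        / (2 * P) ^ 2 - (Y' * (2 * x) - Y * (2 * 1)) / (2 * x) ^ 2
      = ((g₂ * P + 2 * g₃) / (4 * P ^ 2) - (g₂ * x + 2 * g₃) / (4 * x ^ 2)) / Y := by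
  have hYP : Y * (W / Y) = W := mul_div_cancel₀ W hY0
  -- `Y · W′ = f′(P)/2`
  have hYW : 2 * (Y * -(Y' + (s' * (P - x) + s * (W / Y - 1)))) = 12 * P ^ 2 - g₂ := by
    linear_combination -hYY - (P - x) * hkey - 2 * s * hYP - 2 * s * hW + 2 * hM + 2 * s * hch
      - 4 * (3 * P - x - 2 * x₁) * hP
  have h2P : (2 * P) ^ 2 ≠ 0 := by positivity
  have h4P : 4 * P ^ 2 ≠ 0 := by positivity
  have h2x : (2 * x) ^ 2 ≠ 0 := by positivity
  have h4x : 4 * x ^ 2 ≠ 0 := by positivity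
  -- `D(sl/2) = x − X3`
  have k1 : s' / 2 * Y = x - P := by linear_combination hkey / 4 + hP
  -- `D(Y3/(2 X3)) = X3 + h(X3)`
  have k2 : (-(Y' + (s' * (P - x) + s * (W / Y - 1))) * (2 * P) - W * (2 * (W / Y)))
      / (2 * P) ^ 2 * Y = P + (g₂ * P + 2 * g₃) / (4 * P ^ 2) := by
    rw [div_mul_eq_mul_div, add_div' _ _ _ h4P, div_eq_div_iff h2P h4P]
    linear_combination (4 * P ^ 2) * (P * hYW - 2 * W * hYP - 2 * hW2)
  -- `D(yb/(2x)) = x + h(x)`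
  have k3 : (Y' * (2 * x) - Y * (2 * 1)) / (2 * x) ^ 2 * Y = x + (g₂ * x + 2 * g₃) / (4 * x ^ 2) := by
    rw [div_mul_eq_mul_div, add_div' _ _ _ h4x, div_eq_div_iff h2x h4x]
    linear_combination (4 * x ^ 2) * (x * hYY - 2 * hY2)
  rw [eq_div_iff hY0, sub_mul, add_mul]
  linear_combination k1 + k2 - k3

/-- **Pointwise facts along the branch `yb = ε√f` at a point with `f(x) > 0`, `yb x + y₁ ≠ 0`.**
`yb x² = f(x)`, `yb x ≠ 0`, `sl·(yb + y₁) = M`, the chord relation, and the derivatives: `yb′` with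
`2·yb·yb′ = f′`, `sl′` with the key identity `2·yb·sl′ + sl² = 8x + 4x₁`, and part (b)
`X3′ = Y3/yb`. -/
theorem translCalc_pointFacts {g₂ g₃ x₁ y₁ ε : ℝ} {f yb sl X3 Y3 : ℝ → ℝ}
    (hf : ∀ x, f x = 4 * x ^ 3 - g₂ * x - g₃) (hy₁ : y₁ ^ 2 = f x₁) (hε : ε = 1 ∨ ε = -1)
    (hyb : yb = fun x => ε * Real.sqrt (f x))
    (hsl : sl = fun x => (4 * x ^ 2 + 4 * x * x₁ + 4 * x₁ ^ 2 - g₂) / (yb x + y₁))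
    (hX3 : X3 = fun x => sl x ^ 2 / 4 - x - x₁)
    (hY3 : Y3 = fun x => -(yb x + sl x * (X3 x - x))) {x : ℝ} (hpos : 0 < f x)
    (hne : yb x + y₁ ≠ 0) :
    yb x ^ 2 = f x ∧ yb x ≠ 0 ∧ sl x * (yb x + y₁) = 4 * x ^ 2 + 4 * x * x₁ + 4 * x₁ ^ 2 - g₂ ∧
    yb x - y₁ = sl x * (x - x₁) ∧ HasDerivAt X3 (Y3 x / yb x) x ∧
    ∃ Y' s' : ℝ, HasDerivAt yb Y' x ∧ 2 * yb x * Y' = 12 * x ^ 2 - g₂ ∧ HasDerivAt sl s' x ∧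
      2 * yb x * s' + sl x ^ 2 = 8 * x + 4 * x₁ := by
  have hε2 : ε ^ 2 = 1 := by rcases hε with h | h <;> simp [h]
  have hε0 : ε ≠ 0 := by rcases hε with h | h <;> simp [h]
  have hsq : Real.sqrt (f x) ^ 2 = f x := Real.sq_sqrt hpos.le
  have hsqne : Real.sqrt (f x) ≠ 0 := Real.sqrt_ne_zero'.mpr hpos
  have hYx : yb x = ε * Real.sqrt (f x) := by rw [hyb]
  have hY2 : yb x ^ 2 = f x := by rw [hYx, mul_pow, hε2, one_mul, hsq]
  have hY0 : yb x ≠ 0 := by rw [hYx]; exact mul_ne_zero hε0 hsqne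
  have hM : sl x * (yb x + y₁) = 4 * x ^ 2 + 4 * x * x₁ + 4 * x₁ ^ 2 - g₂ := by
    rw [hsl]; exact div_mul_cancel₀ _ hne
  have hch : yb x - y₁ = sl x * (x - x₁) :=
    translCalc_chord (hY2.trans (hf x)) (hy₁.trans (hf x₁)) hM hne
  refine ⟨hY2, hY0, hM, hch, ?_⟩
  -- the derivative of the cubic
  have hfd : HasDerivAt f (12 * x ^ 2 - g₂) x := by
    have hf' : f = fun x => 4 * x ^ 3 - g₂ * x - g₃ := funext hf
    rw [hf']
    refine (((((hasDerivAt_id' x).fun_pow 3).const_mul 4).fun_sub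
      ((hasDerivAt_id' x).const_mul g₂)).sub_const g₃).congr_deriv ?_
    norm_num
    ring
  -- the derivative of the branch `yb = ε √f` and `2 yb yb' = f'`
  have hybd : HasDerivAt yb (ε * ((12 * x ^ 2 - g₂) / (2 * Real.sqrt (f x)))) x := by
    rw [hyb]; exact (hfd.sqrt hpos.ne').const_mul ε
  have hYY : 2 * yb x * (ε * ((12 * x ^ 2 - g₂) / (2 * Real.sqrt (f x)))) = 12 * x ^ 2 - g₂ := by
    have h2 : 2 * Real.sqrt (f x) ≠ 0 := mul_ne_zero two_ne_zero hsqne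
    rw [hYx, show 2 * (ε * Real.sqrt (f x)) * (ε * ((12 * x ^ 2 - g₂) / (2 * Real.sqrt (f x))))
      = ε ^ 2 * (12 * x ^ 2 - g₂) * (2 * Real.sqrt (f x) / (2 * Real.sqrt (f x))) by ring,
      hε2, div_self h2]
    ring
  -- the derivative of the regular-form slope
  have hMd : HasDerivAt (fun x => 4 * x ^ 2 + 4 * x * x₁ + 4 * x₁ ^ 2 - g₂) (8 * x + 4 * x₁) x := by
    refine ((((((hasDerivAt_id' x).fun_pow 2).const_mul 4).fun_add
      (((hasDerivAt_id' x).const_mul 4).mul_const x₁)).add_const (4 * x₁ ^ 2)).sub_const g₂)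
      |>.congr_deriv ?_
    norm_num
    ring
  have hsd : HasDerivAt sl (((8 * x + 4 * x₁) * (yb x + y₁)
      - (4 * x ^ 2 + 4 * x * x₁ + 4 * x₁ ^ 2 - g₂) * (ε * ((12 * x ^ 2 - g₂) / (2 * Real.sqrt (f x)))))
      / (yb x + y₁) ^ 2) x := by
    rw [hsl]; exact hMd.fun_div (hybd.add_const y₁) hne
  have hkey := translCalc_key hne hYY hM hch
  obtain ⟨Y', s', hybd, hYY, hsd, hkey⟩ : ∃ Y' s' : ℝ, HasDerivAt yb Y' x ∧
      2 * yb x * Y' = 12 * x ^ 2 - g₂ ∧ HasDerivAt sl s' x ∧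
      2 * yb x * s' + sl x ^ 2 = 8 * x + 4 * x₁ :=
    ⟨_, _, hybd, hYY, hsd, hkey⟩
  refine ⟨?_, Y', s', hybd, hYY, hsd, hkey⟩
  -- part (b): `X3' = Y3 / yb`
  have hX3x : X3 x = sl x ^ 2 / 4 - x - x₁ := by rw [hX3]
  have hY3x : Y3 x = -(yb x + sl x * (X3 x - x)) := by rw [hY3]
  have hsl2 : HasDerivAt (fun x => sl x ^ 2) (2 * sl x * s') x :=
    (hsd.fun_pow 2).congr_deriv (by norm_num)
  rw [hX3]
  refine (((hsl2.div_const 4).fun_sub (hasDerivAt_id' x)).sub_const x₁).congr_deriv ?_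
  rw [eq_div_iff hY0, hY3x]
  linear_combination (sl x / 4) * hkey + sl x * hX3x

/-- **STUB U4 (`stub_translationCalculus`, size M–L; explicit calculus on the cubic) — translation by an
algebraic point in REGULAR CHORD FORM.** On `y² = f(x) = 4x³ − g₂x − g₃` with a point `P₁ = (x₁, y₁)` and a
branch `yb = ε√f` (`ε = ±1`): slope `sl = M(x)/(yb + y₁)`, `M(x) = 4x² + 4xx₁ + 4x₁² − g₂` (equal to
`(yb − y₁)/(x − x₁)` off `x₁`, regular through the duplication point), sum point `X3 = sl²/4 − x − x₁`,
`Y3 = −(yb + sl(X3 − x))`, cocycle potential `Qf = sl/2 + Y3/(2 X3) − yb/(2x)`. Then: (a) `Y3² = f(X3)`;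
(b) translation invariance of `dx/y`: `X3′ = Y3/yb`; (c) `Qf′ = (h(X3) − h(x))/yb`,
`h(t) = (g₂t + 2g₃)/(4t²)` — the polynomial identity behind it is
`f′(x)(x − x₁) − (f(x) − f(x₁)) = 4(x − x₁)²(2x + x₁)`; (d) point symmetry: with
`(x₃, y₃) = (x, y) ⊕ P₁` in regular form, the chord of `(x₃, −y₃)` with `P₁` returns `(x, −y)` and
`Q(x₃, −y₃) = Q(x, y)` (third point of the line `P₁(x,y)` is `(x₃, −y₃)`, so the two chords have equal slope).
[cite: SilvermanAEC2009, III.2.3] [cite: Lawden1989, §6.8 (6.8.4)] -/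
theorem stub_translationCalculus :
    ∀ (g₂ g₃ x₁ y₁ ε : ℝ) (f yb sl X3 Y3 Qf : ℝ → ℝ),
    (∀ x, f x = 4 * x ^ 3 - g₂ * x - g₃) → y₁ ^ 2 = f x₁ → (ε = 1 ∨ ε = -1) →
    yb = (fun x => ε * Real.sqrt (f x)) →
    sl = (fun x => (4 * x ^ 2 + 4 * x * x₁ + 4 * x₁ ^ 2 - g₂) / (yb x + y₁)) →
    X3 = (fun x => sl x ^ 2 / 4 - x - x₁) →
    Y3 = (fun x => -(yb x + sl x * (X3 x - x))) →
    Qf = (fun x => sl x / 2 + Y3 x / (2 * X3 x) - yb x / (2 * x)) →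
    (∀ x, 0 < f x → yb x + y₁ ≠ 0 → Y3 x ^ 2 = f (X3 x)) ∧
    (∀ x, 0 < f x → yb x + y₁ ≠ 0 → HasDerivAt X3 (Y3 x / yb x) x) ∧
    (∀ x, 0 < f x → yb x + y₁ ≠ 0 → X3 x ≠ 0 → x ≠ 0 →
      HasDerivAt Qf (((g₂ * X3 x + 2 * g₃) / (4 * X3 x ^ 2) - (g₂ * x + 2 * g₃) / (4 * x ^ 2)) / yb x) x) ∧
    (∀ (x y s x₃ y₃ s' x₃' y₃' : ℝ), y ^ 2 = f x → y + y₁ ≠ 0 → x ≠ 0 →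
      s = (4 * x ^ 2 + 4 * x * x₁ + 4 * x₁ ^ 2 - g₂) / (y + y₁) → x₃ = s ^ 2 / 4 - x - x₁ →
      y₃ = -(y + s * (x₃ - x)) → x₃ ≠ 0 → -y₃ + y₁ ≠ 0 →
      s' = (4 * x₃ ^ 2 + 4 * x₃ * x₁ + 4 * x₁ ^ 2 - g₂) / (-y₃ + y₁) → x₃' = s' ^ 2 / 4 - x₃ - x₁ →
      y₃' = -(-y₃ + s' * (x₃' - x₃)) →
      x₃' = x ∧ y₃' = -y ∧
      s' / 2 + y₃' / (2 * x₃') - -y₃ / (2 * x₃) = s / 2 + y₃ / (2 * x₃) - y / (2 * x)) := by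
  intro g₂ g₃ x₁ y₁ ε f yb sl X3 Y3 Qf hf hy₁ hε hyb hsl hX3 hY3 hQf
  refine ⟨?_, ?_, ?_, ?_⟩
  · -- (a) the sum point is on the curve
    intro x hpos hne
    obtain ⟨hY2, -, hM, hch, -, -⟩ := translCalc_pointFacts hf hy₁ hε hyb hsl hX3 hY3 hpos hne
    have hX3x : X3 x = sl x ^ 2 / 4 - x - x₁ := by rw [hX3]
    have hY3x : Y3 x = -(yb x + sl x * (X3 x - x)) := by rw [hY3]
    rw [hY3x, hX3x, hf]
    exact translCalc_onCurve (hY2.trans (hf x)) hch hM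
  · -- (b) translation invariance of `dx/y`
    intro x hpos hne
    exact (translCalc_pointFacts hf hy₁ hε hyb hsl hX3 hY3 hpos hne).2.2.2.2.1
  · -- (c) the derivative of the cocycle potential
    intro x hpos hne hP0 hx0
    obtain ⟨hY2, hY0, hM, hch, hX3d, Y', s', hybd, hYY, hsd, hkey⟩ :=
      translCalc_pointFacts hf hy₁ hε hyb hsl hX3 hY3 hpos hne
    have hX3x : X3 x = sl x ^ 2 / 4 - x - x₁ := by rw [hX3]
    have hY3x : Y3 x = -(yb x + sl x * (X3 x - x)) := by rw [hY3]
    have hW2 : Y3 x ^ 2 = 4 * X3 x ^ 3 - g₂ * X3 x - g₃ := by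
      rw [hY3x, hX3x]; exact translCalc_onCurve (hY2.trans (hf x)) hch hM
    have hY3d : HasDerivAt Y3 (-(Y' + (s' * (X3 x - x) + sl x * (Y3 x / yb x - 1)))) x :=
      (hybd.fun_add (hsd.fun_mul (hX3d.fun_sub (hasDerivAt_id' x)))).fun_neg.congr_of_eventuallyEq
        (Filter.Eventually.of_forall fun t => congrFun hY3 t)
    rw [hQf]
    refine (((hsd.div_const 2).fun_add (hY3d.fun_div (hX3d.const_mul 2)
      (mul_ne_zero two_ne_zero hP0))).fun_sub (hybd.fun_div ((hasDerivAt_id' x).const_mul 2)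
      (mul_ne_zero two_ne_zero hx0))).congr_deriv ?_
    exact translCalc_QfIdentity hY0 hP0 hx0 hYY hkey hX3x hY3x hM hch hW2 (hY2.trans (hf x))
  · -- (d) point symmetry of the regular chord construction
    intro x y s x₃ y₃ s' x₃' y₃' _hy hne _hx hs hx₃ hy₃ _hx₃ hne' hs' hx₃' hy₃'
    have hM : s * (y + y₁) = 4 * x ^ 2 + 4 * x * x₁ + 4 * x₁ ^ 2 - g₂ := by
      rw [hs]; exact div_mul_cancel₀ _ hne
    have hss : s' = s := by
      rw [hs', div_eq_iff hne', hy₃, hx₃]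
      linear_combination -hM
    have hxx : x₃' = x := by rw [hx₃', hss, hx₃]; ring
    have hyy : y₃' = -y := by rw [hy₃', hss, hxx, hy₃]; ring
    refine ⟨hxx, hyy, ?_⟩
    rw [hss, hxx, hyy]
    ring

end Summit.KontsevichZagierPeriods.KontsevichZagierPeriods.Cruxes.NeronTorsionSector.Translation

end
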